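import Summits.QuantumFields.YangMills.Theorems.OnsetSkewLawRPOnsetFloorCellShiftCore
import HarnessLib

/-!
# Crux `OnsetSkewLaw.RPOnsetFloor` (stmt-QuantumFields-23138), LINE «FloorInheritance» (planner ym-idea-11 g13, registered
# skeleton `pub/ideators/ym-idea-11/g13/floor-inheritance.lean` v5, sha 09e801d0): the registered stub `stub_cellShift` BY NAME

LINE 2's own tail `stub_cellShift : StubCellShiftP` (size M on the card): for an admissible collar bump `b`, any `β ≥ 0` and any
odd-torus limit state `μ`, every coarse positive-time collar atom `(q, s, y)` has a CELL representative `y' ∈ [0,s]⁴` with at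
least the same reflection-positivity square.  The mathematics is part I, `OnsetSkewLawRPOnsetFloorCellShiftCore.lean`
(`rpSq_timeShift_le` = general-`G` `OnsetContraction`: site-RP at `β ≥ 0` + translation invariance + Osterwalder–Seiler
contraction; `rpSq_spatialShift_eq` = spatial `ℤ³`-invariance; `cellShift_core` = the let-free statement).  This file records
the registered statement VERBATIM (`E4` spelled out; `abbrev AdmBump`, `abbrev StubCellShiftP` are registered-stub copies, not
citable facts — the pattern of `OnsetSkewLawRPOnsetFloorUVQuiet.lean`) and closes it: **`stub_cellShift : StubCellShiftP`**.
The stub's hypotheses `s ≤ 1`, `q.1 < q.2`, the collar inequality, simplicity of `G` and all of `AdmBump` except compact support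
in `{u₀ > 0}` are idle.  Compatibility: with this file imported, the skeleton's `theorem stub_cellShift : StubCellShiftP :=
Summit.QuantumFields.YangMills.Theorems.RPOnsetFloorCellShift.stub_cellShift` elaborates (checked, rc 0).

HONEST FRAMING: one bookkeeping stub of an OPEN line; `stub_singleSlot`, `stub_positiveTimeSynthesisCollar`,
`stub_coarseCollarAtomRPFloor`, the residual `OnsetFloorQ2`, the crux 23138, every rung and the summit are untouched; the
Yang–Mills mass gap is NOT proved.  Cell `ym-idea-1`, width seat `ym-line-sfw-p2-w5` g16 (free hands).
References: K. Osterwalder, E. Seiler, Ann. Phys. 110 (1978) 440, §2 [OsterwalderSeiler1978]. [folklore]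
-/

set_option autoImplicit false

noncomputable section

open MeasureTheory
open Literature.MathematicalPhysics.QuantumFieldTheory Literature.MathematicalPhysics.QuantumLattice
open Summit.QuantumFields.YangMills.Theorems.InfiniteVolume (stateMomentStr)
open Summit.QuantumFields.YangMills.Theorems.InfVolRP (centreOffset)

namespace Summit.QuantumFields.YangMills.Theorems.RPOnsetFloorCellShift

/-! ## §4 The registered stub, BY NAME -/

/-- ADMISSIBLE COLLAR BUMP (verbatim the skeleton's `AdmBump`, `E4` spelled out; registered-stub copy, not a citable fact):
compact support inside `[0,R₀]⁴ ∩ {u₀ > 0}`, `∫ b ≠ 0`, permutation symmetric, time-symmetric `b(t − u₀, u⃗) = b(u)`. -/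
abbrev AdmBump (b : SchwartzMap (EuclideanSpace ℝ (Fin 4)) ℝ) (R₀ t : ℝ) : Prop :=
  HasCompactSupport b ∧ tsupport b ⊆ {u : EuclideanSpace ℝ (Fin 4) | ∀ j, 0 ≤ u j ∧ u j ≤ R₀} ∧
  tsupport b ⊆ {u : EuclideanSpace ℝ (Fin 4) | 0 < u 0} ∧ (∫ u, b u) ≠ 0 ∧
  (∀ (π : Equiv.Perm (Fin 4)) (u : EuclideanSpace ℝ (Fin 4)), b (WithLp.toLp 2 fun i => u (π i)) = b u) ∧
  (∀ u : EuclideanSpace ℝ (Fin 4), b (WithLp.toLp 2 fun i => if i = 0 then t - u i else u i) = b u)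

/-- The registered stub statement `StubCellShiftP` of LINE «FloorInheritance» v5 (verbatim, `E4` spelled out; registered-stub
copy, not a citable fact): for an admissible collar bump, any `β ≥ 0`, any odd-torus limit state, every coarse positive-time
collar atom `(q, s, y)` has a cell representative `y' ∈ [0,s]⁴` with at least the same RP square. -/
abbrev StubCellShiftP : Prop :=
  ∀ (G : Type) [Group G] [TopologicalSpace G] [IsTopologicalGroup G] [CompactSpace G],
    IsCompactSimpleLieGroup G →
    letI : MeasurableSpace G := borel G
    haveI : BorelSpace G := ⟨rfl⟩
    ∀ (r : LatticeRep G) (b : SchwartzMap (EuclideanSpace ℝ (Fin 4)) ℝ) (R₀ t : ℝ), AdmBump b R₀ t →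
      ∀ (β : ℝ), 0 ≤ β → ∀ μ ∈ oddTorusLimitPoints r β,
        let wt : Finset (Fin 4 × Fin 4) → ℝ → EuclideanSpace ℝ (Fin 4) → (Fin 4 × Fin 4) × (Fin 4 → ℤ) → ℝ := fun Q s y p => if p.1 ∈ Q ∧ p.1.1 < p.1.2 then b (s • (siteToE p.2 + centreOffset p.1) - y) else 0 ; let wr : Finset (Fin 4 × Fin 4) → ℝ → EuclideanSpace ℝ (Fin 4) → (Fin 4 × Fin 4) × (Fin 4 → ℤ) → ℝ := fun Q s y p => if p.1 ∈ Q ∧ p.1.1 < p.1.2 then b (timeReflection 4 (s • (siteToE p.2 + centreOffset p.1)) - y) else 0 ; let rpSq : Finset (Fin 4 × Fin 4) → ℝ → EuclideanSpace ℝ (Fin 4) → ℝ := fun Q s y => ∑' pp : ((Fin 4 × Fin 4) × (Fin 4 → ℤ)) × ((Fin 4 × Fin 4) × (Fin 4 → ℤ)), wr Q s y pp.1 * wt Q s y pp.2 * stateMomentStr G r μ 2 ![pp.1.1, pp.2.1] ![pp.1.2, pp.2.2] ; ∀ s : ℝ, 0 < s → s ≤ 1 → ∀ (q : Fin 4 ×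 Fin 4) (y : EuclideanSpace ℝ (Fin 4)), q.1 < q.2 → 0 ≤ y 0 →
          R₀ + 1 + 9 * s ≤ 2 * y 0 + t →
          ∃ y' : EuclideanSpace ℝ (Fin 4), (∀ i, 0 ≤ y' i ∧ y' i ≤ s) ∧ rpSq {q} s y ≤ rpSq {q} s y'

/-- **`stub_cellShift` of LINE «FloorInheritance», BY NAME**: every coarse positive-time collar atom has a cell representative
with at least the same RP square, in every odd-torus limit state at `β ≥ 0` (`cellShift_core`; the simple-group hypothesis,
`s ≤ 1`, `q.1 < q.2`, the collar inequality and all of `AdmBump` but compact support in `{u₀ > 0}` are idle).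
[cite: OsterwalderSeiler1978, §2] -/
theorem stub_cellShift : StubCellShiftP := by
  intro G _ _ _ _ _hG r b R₀ t hb β hβ μ hμ wt wr rpSq s hs _hs1 q y _hq hy _hcol
  letI : MeasurableSpace G := borel G
  haveI : BorelSpace G := ⟨rfl⟩
  exact cellShift_core r hβ hμ hb.1 hb.2.2.1 q hs y hy

end Summit.QuantumFields.YangMills.Theorems.RPOnsetFloorCellShift

end
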